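import Literature.AlgebraicGeometry.Resolution.LinearProjectionChoice
import Literature.AlgebraicGeometry.Resolution.LinearProjectionSmoothFibre
import Literature.AlgebraicGeometry.Resolution.AlterationsLemma411Vertex
import Literature.AlgebraicGeometry.Resolution.BlowupsProperProofs
import Literature.AlgebraicGeometry.Motives.VarietiesProperProofs
import HarnessLib

/-!
# De Jong 1996, Lemma 4.11: the choice of the projection `π` — `DeJong1996Lemma411VertexChoice_holds`

Topic: `Literature/AlgebraicGeometry/Resolution`. DISCHARGE of the named fact
`DeJong1996Lemma411VertexChoice` (`AlterationsLemma411Vertex.lean`; de Jong 1996, proof of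
Lemma 4.11, p. 68: the finite morphism `π : X → ℙ^d`, étale over a general point `p ∉ B ∪ π(Z)`,
with `Z → π(Z) → ℙ^{d-1}` generically étale "by construction" (2.11) and, `X` being normal,
"by Bertini's theorem […] the general fibre of `f` is smooth" — rendered with `p` the vertex of
`ℙ^{d+1}`).

The proof assembles the linear-projection files of this series: an embedding `X ↪ ℙ^N_k` from
projectivity; the linear forms `t₀, …, t_{d+1}` of `LinSec.exists_goodForms`
(`LinearProjectionChoice`: no common zero, none of `t₀, …, t_d` vanishing simultaneously on `Z`,
`(t₀, …, t_d)_x = 𝔪_x` over the vertex, independent jets at one regular point of every component of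
`Z`, regular curve sections if `X` is normal); the projection `π = (t₀ : … : t_{d+1})`
(`LinearProjection`, `LinearProjectionVertex`: finite, surjective, étale over a neighbourhood of the
vertex, `vertex ∉ π(Z)`); generic étaleness of `pr ∘ π|_Z` (`LinearProjectionZJets`,
`LinearProjectionZEtale`) and hence (ii) c) for every vertex blow-up `(P̃, b, q)`
(`Lemma411OffVertex`); and the smooth fibre over `y₀ = (0 : … : 0 : 1)` in the normal case
(`LinearProjectionSmoothFibre`, `Lemma411SmoothFibreCriterion`).

## References

* A. J. de Jong, *Smoothness, semi-stability and alterations*, Publ. Math. IHÉS 83 (1996),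
  Lemma 4.11 and its proof, pp. 67–68; 2.11. [DeJong1996]
* R. Hartshorne, *Algebraic Geometry* (1977), II Thm. 8.18. [Hartshorne1977]
* H. Matsumura, *Commutative Ring Theory* (1986), Thm. 23.1. [Matsumura1987]
-/

noncomputable section

open CategoryTheory CategoryTheory.Limits AlgebraicGeometry TopologicalSpace Topology IsLocalRing
open Literature.AlgebraicGeometry.Morphisms.ProjCech (grading PP)
open Literature.AlgebraicGeometry.Motives
open Literature.AlgebraicGeometry.Motives.RatFn
open Scheme.IdealSheafData

attribute [local instance] MvPolynomial.gradedAlgebra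
  Literature.AlgebraicGeometry.Motives.ProjBaseChange.algebraBase

namespace Literature.AlgebraicGeometry.Resolution

universe u

open DeJong1996 LinSec
open Literature.AlgebraicGeometry.Motives.Segre (toSpec)

set_option maxHeartbeats 1600000 in
/-- DISCHARGE of `DeJong1996Lemma411VertexChoice`: **the projection `π = (t₀ : … : t_{d+1})` of
de Jong's Lemma 4.11 exists**, with `p` the vertex: `π` is a finite surjective `k`-morphism étale
over a neighbourhood of the vertex with `vertex ∉ π(Z)`, and for every blowing up `(P̃, b, q)` of
`ℙ^{d+1}` in the vertex with its projection `q`, `f|_{Z'}` is finite and generically étale and —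
`X` normal — some fibre of `f = pr₂ ≫ q` is smooth. [cite: DeJong1996, Lemma 4.11 (proof), p. 68] -/
theorem DeJong1996Lemma411VertexChoice_holds : DeJong1996Lemma411VertexChoice.{u} := by
  intro k _ _ X fX Z d hint hX hZD hdim
  classical
  haveI := hint
  letI : X.Over (Spec (.of k)) := ⟨fX⟩
  haveI : IsProper (X ↘ Spec (.of k)) := IsProjectiveOver.isProper (X := Over.mk fX) hX
  obtain ⟨D, hD, hDZ⟩ := hZD
  have hZ : IsClosed Z := by rw [← hDZ]; exact D.support.isClosed
  -- an embedding `X ↪ ℙ^N_k`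
  obtain ⟨N, ιO, hcl⟩ := hX
  let ι : X ⟶ PP k N := ιO.left
  haveI : IsClosedImmersion ι := hcl
  have hι : ι ≫ Literature.AlgebraicGeometry.Morphisms.ProjCech.toSpec k N = X ↘ Spec (.of k) :=
    Over.w ιO
  haveI : IsLocallyNoetherian X := LocallyOfFiniteType.isLocallyNoetherian (X ↘ Spec (.of k))
  -- the forms and the projection
  obtain ⟨t, hC1, hC2, hC3, hC4, hC5⟩ := exists_goodForms ι hι hdim hZ hD hDZ
  have hπS : proj ι t (X ↘ Spec (.of k)) hC1 ≫ toSpec (Fin (d + 1 + 1)) k = X ↘ Spec (.of k) :=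
    proj_toSpec ι t _ hC1
  haveI : IsAffineHom (proj ι t (X ↘ Spec (.of k)) hC1) := isAffineHom_proj ι t _ hC1
  haveI : IsFinite (proj ι t (X ↘ Spec (.of k)) hC1) := isFinite_proj ι t _ hC1
  haveI : IsProper (proj ι t (X ↘ Spec (.of k)) hC1 ≫ toSpec (Fin (d + 1 + 1)) k) := by
    rw [hπS]; infer_instance
  have hunr : ∀ x : X, proj ι t (X ↘ Spec (.of k)) hC1 x = vertex d k →
      cutIdeal ι x (tInit t) = maximalIdeal (X.presheaf.stalk x) := fun x hx =>
    (hC3 x ((proj_eq_vertex_iff ι t _ hC1 x).mp hx)).2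
  obtain ⟨V, hvV, hVet⟩ := exists_etale_morphismRestrict_proj_vertex ι t _ hC1 hdim hunr
  have hπZ : vertex d k ∉ proj ι t (X ↘ Spec (.of k)) hC1 '' Z :=
    vertex_notMem_image_proj ι t _ hC1 hC2
  refine ⟨proj ι t (X ↘ Spec (.of k)) hC1, ⟨hπS, isFinite_proj ι t _ hC1,
    surjective_proj ι t _ hC1 hdim, ⟨V, hvV, hVet⟩, hπZ⟩, ?_⟩
  intro P b q hM hV
  haveI : IsProper (toSpec (Fin (d + 1 + 1)) k) := ProjSpace.isProper_over (d + 1) k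
  haveI : IsProper (toSpec (Fin (d + 1)) k) := ProjSpace.isProper_over d k
  haveI : IsLocallyNoetherian (ProjSpace.P (d + 1) k) :=
    LocallyOfFiniteType.isLocallyNoetherian (toSpec (Fin (d + 1 + 1)) k)
  haveI : IsLocallyNoetherian (projectiveSpace (d + 1) k).left := ‹IsLocallyNoetherian (ProjSpace.P (d + 1) k)›
  constructor
  · -- (ii) c): `f|_{Z'}` finite and generically étale
    refine isFiniteGenericallyEtaleOn_fibration_of_isGenericallyEtale d k
      (proj ι t (X ↘ Spec (.of k)) hC1) hZ hπZ hM.isBlowup hV ?_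
    refine isGenericallyEtale_reducedProjection d (proj ι t (X ↘ Spec (.of k)) hC1) hZ hπZ
      (X ↘ Spec (.of k)) hπS fun w hw => ?_
    obtain ⟨z, hzZ, hwz, hzc, h, hz, hreg, hdimR, hind, h0⟩ := hC4 w hw
    haveI := hreg
    have hJm : stalkIdeal (vanishingIdeal ⟨Z, hZ⟩) z ≤ maximalIdeal (X.presheaf.stalk z) :=
      (mem_support_iff_stalkIdeal_le _ z).mp (by
        rw [← SetLike.mem_coe, coe_support_vanishingIdeal]; exact hzZ)
    obtain ⟨hxP, lam, hJ⟩ := exists_span_ratioGerm_sub_constGerm_sup_eq ι hι t hC1 hz hzc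
      (stalkIdeal (vanishingIdeal ⟨Z, hZ⟩) z) hJm hdimR hind h0
    refine ⟨z, hzZ, hwz, hzc, 0, hxP, lam, hJ, fun z' hz' => ?_⟩
    rw [ringKrullDim_stalk_reduced_eq hZ z' hz', hdimR]
  · -- `X` normal: the fibre over `y₀` is smooth
    intro hN
    haveI : @IsProper P (ProjSpace.P (d + 1) k) b := hM.isBlowup.isProper
    haveI : @Smooth P (ProjSpace.P d k) q := hM.smooth
    haveI := hVet
    haveI : LocallyOfFiniteType (proj ι t (X ↘ Spec (.of k)) hC1 ≫ toSpec (Fin (d + 1 + 1)) k) := by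
      rw [hπS]; infer_instance
    haveI : LocallyOfFinitePresentation (offVertexProjection d k (proj ι t (X ↘ Spec (.of k)) hC1)) :=
      locallyOfFinitePresentation_offVertexProjection k d _
    refine ⟨yZero k d, smooth_fiberToSpecResidueField_fibration d (proj ι t (X ↘ Spec (.of k)) hC1)
      (X ↘ Spec (.of k)) hM.isBlowup hV hM.comp_hom V hvV (yZero k d) (isClosed_singleton_yZero k d)
      fun x hxc hy => ?_⟩
    exact mem_smoothLocus_offVertexProjection_proj ι hdim t hC1 (hC5 hN) x hxc hy

end Literature.AlgebraicGeometry.Resolution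

end
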